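import Mathlib.Algebra.Group.Action.Sigma
import Mathlib.Algebra.Group.Action.Sum
import Literature.RepresentationTheory.FiniteGroups.ArtinInductionTheorem
import Literature.RepresentationTheory.FiniteGroups.PermutationCharacter
import Literature.RepresentationTheory.FiniteGroups.GassmannEquivalentPermutationModules
import HarnessLib

/-!
# Artin's induction theorem as a ℚ-isomorphism of permutation modules: `|G|` points plus
# `G`-sets with cyclic stabilisers on both sides (Isaacs, *Character Theory of Finite Groups*,
# Cor. 5.23; Serre, *Linear Representations of Finite Groups*, §13.1 Ex. 13.5 / §12.5 Thm. 26)

Topic `RepresentationTheory/FiniteGroups`; namespace `Literature.RepresentationTheory.FiniteGroups`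
(sub-namespace `ArtinGassmann`).  THEOREMS ONLY (no definition, no named fact, no `sorry`, no
instance).  A CONSEQUENCE, stated integrally on `G`-SETS, of two tree theorems:

* Artin (Isaacs Cor. 5.23, tree `ArtinInductionTheorem`,
  `IsCharacter.exists_card_smul_eq_sum_cyclic_intCast_smul_indClassFun`): for a rational valued
  character `χ` of the finite group `G`, `|G| χ = Σ_H b_H (1_H)^G` with `b_H ∈ ℤ`, `H` over the
  CYCLIC subgroups — applied to `χ = 1` and read pointwise through the permutation character
  `(1_H)^G (g) = #Fix_g(G/H)` (tree `indClassFun_one_eq_natCard_fixedBy_quotient`):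
  `|G| + Σ_{b_H<0} |b_H| · #Fix_g(G/H) = Σ_{b_H>0} b_H · #Fix_g(G/H)` for every `g ∈ G`;
* Lin–Shinder–Zimmermann / Gassmann (tree `GassmannEquivalentPermutationModules`,
  `nonempty_equiv_ofMulAction_iff_forall_natCard_fixedBy_eq_field`): finite `G`-sets with the same
  fixed-point counts for every `g` have ISOMORPHIC permutation modules over any field of
  characteristic `0`.

Hence (`exists_ratEquiv_points_sum_cyclic`) there are finite families `(H₁ i)`, `(H₂ j)` of CYCLIC
subgroups with a `G`-equivariant `ℚ`-linear isomorphism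
`ℚ[|G|·pt ⊔ ⊔_i G/H₁ i] ≅ ℚ[⊔_j G/H₂ j]` (`|G|·pt` realised as `|G|` copies of `G/G`).  This is the
form in which Artin's theorem enters Tate's Euler–Poincaré characteristic argument (Milne, *ADT* I
Lemma 2.10: reduction to cyclic subgroups) without the Grothendieck group `R_𝔽ₚ(G)`: an additive
invariant of `𝔽_p[G]`-modules is transported along the isomorphism via commensurable lattices
(`StableLatticeReductionInvariantInt`, `LatticesInRationalRepresentation`) — road memo
`TATE-EPC-TC-ROAD` (evidence #54 on stmt-BirchSwinnertonDyer-19032), brick B3b-1.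

Also: the fixed points of `g` on `Σ i, X i` and on `X ⊕ Y` (`natCard_fixedBy_sigma`,
`natCard_fixedBy_sum`) and on `G/G` (`natCard_fixedBy_quotient_top`).

## References
* I. M. Isaacs, *Character Theory of Finite Groups*, Academic Press (1976), Thm. 5.21, Cor. 5.23.
  [Isaacs1976]
* J.-P. Serre, *Linear Representations of Finite Groups*, GTM 42 (1977), §12.5 Thm. 26, §13.1
  Ex. 13.5. [SerreLinearRepresentations1977]
* J. S. Milne, *Arithmetic Duality Theorems*, 2nd ed. (2006), I Lemma 2.10 (p. 32). [MilneADT2006]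
-/

namespace Literature.RepresentationTheory.FiniteGroups

namespace ArtinGassmann

open MulAction Finset

/-! ### §1. Fixed points on sums of `G`-sets -/

section Fixed

variable {G : Type*} [Group G]

/-- Fixed points of `g` on a `Σ`-type of `G`-sets are the `Σ`-type of the fixed points.
[cite: SerreLinearRepresentations1977, §13.1 Ex. 13.5] -/
theorem natCard_fixedBy_sigma {ι : Type*} [Fintype ι] (X : ι → Type*) [∀ i, MulAction G (X i)]
    [∀ i, Finite (X i)] (g : G) :
    Nat.card (fixedBy (Σ i, X i) g) = ∑ i, Nat.card (fixedBy (X i) g) := by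
  classical
  rw [← Nat.card_sigma]
  refine Nat.card_congr
    { toFun := fun x => ⟨x.1.1, ⟨x.1.2, ?_⟩⟩
      invFun := fun y => ⟨⟨y.1, y.2.1⟩, ?_⟩
      left_inv := fun x => rfl
      right_inv := fun y => rfl }
  · have h := x.2
    rw [mem_fixedBy] at h ⊢
    obtain ⟨⟨i, x⟩, hx⟩ := x
    simp only [Sigma.smul_mk, Sigma.mk.inj_iff, heq_eq_eq, true_and] at h
    exact h
  · have h := y.2.2
    rw [mem_fixedBy] at h ⊢
    rw [Sigma.smul_mk, h]

/-- Fixed points of `g` on `X ⊕ Y`. [cite: SerreLinearRepresentations1977, §13.1 Ex. 13.5] -/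
theorem natCard_fixedBy_sum (X Y : Type*) [MulAction G X] [MulAction G Y] [Finite X] [Finite Y]
    (g : G) : Nat.card (fixedBy (X ⊕ Y) g) = Nat.card (fixedBy X g) + Nat.card (fixedBy Y g) := by
  rw [← Nat.card_sum]
  refine Nat.card_congr
    { toFun := fun x => match x with
        | ⟨Sum.inl a, h⟩ => Sum.inl ⟨a, by rw [mem_fixedBy] at h ⊢; simpa [Sum.smul_inl] using h⟩
        | ⟨Sum.inr b, h⟩ => Sum.inr ⟨b, by rw [mem_fixedBy] at h ⊢; simpa [Sum.smul_inr] using h⟩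
      invFun := fun y => match y with
        | Sum.inl ⟨a, h⟩ => ⟨Sum.inl a, by rw [mem_fixedBy] at h ⊢; rw [Sum.smul_inl, h]⟩
        | Sum.inr ⟨b, h⟩ => ⟨Sum.inr b, by rw [mem_fixedBy] at h ⊢; rw [Sum.smul_inr, h]⟩
      left_inv := fun x => by rcases x with ⟨a | b, h⟩ <;> rfl
      right_inv := fun y => by rcases y with ⟨a, h⟩ | ⟨b, h⟩ <;> rfl }

/-- Every `g` fixes the one point of `G/G`. [cite: SerreLinearRepresentations1977, §13.1 Ex. 13.5] -/
theorem natCard_fixedBy_quotient_top (g : G) : Nat.card (fixedBy (G ⧸ (⊤ : Subgroup G)) g) = 1 := by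
  haveI : Subsingleton (G ⧸ (⊤ : Subgroup G)) := QuotientGroup.subsingleton_quotient_top
  haveI : Nonempty (fixedBy (G ⧸ (⊤ : Subgroup G)) g) :=
    ⟨⟨(1 : G), by rw [mem_fixedBy]; exact Subsingleton.elim _ _⟩⟩
  exact Nat.card_unique

end Fixed

/-! ### §2. Artin's identity pointwise, and the two `G`-sets -/

section Artin

variable {G : Type} [Group G] [Fintype G]

/-- **Artin's Cor. 5.23 at `χ = 1`, pointwise and over `ℤ`**: there are integers `b_H`, `H` over the
cyclic subgroups, with `|G| = Σ_H b_H · #Fix_g(G/H)` for every `g`.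
[cite: Isaacs1976, Cor. 5.23] [cite: SerreLinearRepresentations1977, §12.5 Thm. 26] -/
theorem exists_card_eq_sum_intCast_mul_natCard_fixedBy [DecidableEq (Subgroup G)] :
    ∃ b : Subgroup G → ℤ, ∀ g : G, (Fintype.card G : ℤ) =
      ∑ H ∈ Finset.univ.image (fun z : G => Subgroup.zpowers z),
        b H * (Nat.card (fixedBy (G ⧸ H) g) : ℤ) := by
  obtain ⟨b, hb⟩ := IsCharacter.exists_card_smul_eq_sum_cyclic_intCast_smul_indClassFun
    (isCharacter_one (G := G)) (fun _ => ⟨1, by simp⟩)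
  refine ⟨b, fun g => ?_⟩
  have h := congrFun hb g
  simp only [Pi.smul_apply, Pi.one_apply, smul_eq_mul, mul_one, Finset.sum_apply,
    indClassFun_one_eq_natCard_fixedBy_quotient] at h
  exact_mod_cast h

/-- **Artin's theorem as an equality of fixed-point counts of two `G`-sets**: with the cyclic
subgroups `H` (the generator-indexed Finset `S`) and Artin's integers `b_H`, the `G`-sets
`A = |G|·(G/G) ⊔ ⊔_{(H, _) : Σ_{H ∈ S} Fin (b_H)⁻} G/H` and `B = ⊔_{(H, _) : Σ_{H ∈ S} Fin (b_H)⁺} G/H` have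
`#Fix_g(A) = #Fix_g(B)` for every `g`.
[cite: Isaacs1976, Cor. 5.23] [cite: SerreLinearRepresentations1977, §13.1 Ex. 13.5] -/
theorem natCard_fixedBy_artinSets_eq [DecidableEq (Subgroup G)] (b : Subgroup G → ℤ)
    (hb : ∀ g : G, (Fintype.card G : ℤ) =
      ∑ H ∈ Finset.univ.image (fun z : G => Subgroup.zpowers z),
        b H * (Nat.card (fixedBy (G ⧸ H) g) : ℤ)) (g : G) :
    Nat.card (fixedBy ((Σ _ : Fin (Fintype.card G), G ⧸ (⊤ : Subgroup G)) ⊕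
        (Σ i : (Σ H : Finset.univ.image (fun z : G => Subgroup.zpowers z), Fin (-(b H)).toNat),
          G ⧸ (i.1 : Subgroup G))) g) =
      Nat.card (fixedBy (Σ j : (Σ H : Finset.univ.image (fun z : G => Subgroup.zpowers z),
          Fin (b H).toNat), G ⧸ (j.1 : Subgroup G)) g) := by
  set S := Finset.univ.image (fun z : G => Subgroup.zpowers z) with hS
  have h := hb g
  rw [← Finset.sum_attach S] at h
  -- the three pieces, as sums over `S`
  have hpt : Nat.card (fixedBy (Σ _ : Fin (Fintype.card G), G ⧸ (⊤ : Subgroup G)) g) =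
      Fintype.card G := by
    rw [natCard_fixedBy_sigma]
    simp only [natCard_fixedBy_quotient_top, Finset.sum_const, Finset.card_univ, Fintype.card_fin,
      smul_eq_mul, mul_one]
  have hneg : Nat.card (fixedBy (Σ i : (Σ H : S, Fin (-(b H)).toNat), G ⧸ (i.1 : Subgroup G)) g) =
      ∑ H : S, (-(b H)).toNat * Nat.card (fixedBy (G ⧸ (H : Subgroup G)) g) := by
    rw [natCard_fixedBy_sigma, Fintype.sum_sigma]
    refine Finset.sum_congr rfl fun x _ => ?_
    show ∑ _y : Fin (-(b x)).toNat, Nat.card (fixedBy (G ⧸ (x : Subgroup G)) g) = _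
    rw [Finset.sum_const, Finset.card_univ, Fintype.card_fin, smul_eq_mul]
  have hpos : Nat.card (fixedBy (Σ j : (Σ H : S, Fin (b H).toNat), G ⧸ (j.1 : Subgroup G)) g) =
      ∑ H : S, (b H).toNat * Nat.card (fixedBy (G ⧸ (H : Subgroup G)) g) := by
    rw [natCard_fixedBy_sigma, Fintype.sum_sigma]
    refine Finset.sum_congr rfl fun x _ => ?_
    show ∑ _y : Fin (b x).toNat, Nat.card (fixedBy (G ⧸ (x : Subgroup G)) g) = _
    rw [Finset.sum_const, Finset.card_univ, Fintype.card_fin, smul_eq_mul]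
  rw [natCard_fixedBy_sum, hpt, hneg, hpos]
  -- an identity of natural numbers; move to `ℤ` and use Artin's identity `h`
  zify
  rw [h, Finset.univ_eq_attach, ← Finset.sum_add_distrib]
  refine Finset.sum_congr rfl fun x _ => ?_
  rw [← add_mul]
  congr 1
  have hx := Int.toNat_sub_toNat_neg (b x)
  linarith

end Artin

/-! ### §3. The ℚ-isomorphism of permutation modules -/

/-- **Artin's induction theorem as a `ℚ[G]`-isomorphism of permutation modules.**  For a finite group
`G` there are finite families `H₁`, `H₂` of CYCLIC subgroups and a `G`-equivariant `ℚ`-linear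
isomorphism `ℚ[|G|·(G/G) ⊔ ⊔_i G/H₁ i] ≅ ℚ[⊔_j G/H₂ j]` (Artin's integers `b_H`: `H₁` lists each cyclic
`H` with `b_H < 0` `|b_H|` times, `H₂` each `H` with `b_H > 0` `b_H` times; the two `G`-sets have the
same fixed-point counts, hence Gassmann-equivalent permutation modules).
[cite: Isaacs1976, Cor. 5.23] [cite: SerreLinearRepresentations1977, §13.1 Ex. 13.5 and §12.5 Thm. 26]
[cite: MilneADT2006, I Lemma 2.10] -/
theorem exists_ratEquiv_points_sum_cyclic (G : Type) [Group G] [Fintype G] :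
    ∃ (ι₁ ι₂ : Type) (_ : Fintype ι₁) (_ : Fintype ι₂) (H₁ : ι₁ → Subgroup G)
      (H₂ : ι₂ → Subgroup G), (∀ i, IsCyclic (H₁ i)) ∧ (∀ j, IsCyclic (H₂ j)) ∧
      Nonempty ((Representation.ofMulAction ℚ G
        ((Σ _ : Fin (Fintype.card G), G ⧸ (⊤ : Subgroup G)) ⊕ (Σ i, G ⧸ H₁ i))).Equiv
        (Representation.ofMulAction ℚ G (Σ j, G ⧸ H₂ j))) := by
  classical
  obtain ⟨b, hb⟩ := exists_card_eq_sum_intCast_mul_natCard_fixedBy (G := G)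
  set S := Finset.univ.image (fun z : G => Subgroup.zpowers z) with hS
  have hcyc : ∀ H : S, IsCyclic (H : Subgroup G) := by
    rintro ⟨H, hH⟩
    obtain ⟨z, -, rfl⟩ := Finset.mem_image.1 hH
    exact Subgroup.isCyclic_zpowers z
  refine ⟨(Σ H : S, Fin (-(b H)).toNat), (Σ H : S, Fin (b H).toNat), inferInstance, inferInstance,
    fun i => i.1, fun j => j.1, fun i => hcyc i.1, fun j => hcyc j.1, ?_⟩
  exact (nonempty_equiv_ofMulAction_iff_forall_natCard_fixedBy_eq_field ℚ).2
    (natCard_fixedBy_artinSets_eq b hb)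


end ArtinGassmann

end Literature.RepresentationTheory.FiniteGroups
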